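import Literature.NumberTheory.LFunctions.WeilGroundEnergyParitySplit
import Literature.NumberTheory.LFunctions.WeilGroundStateRealZerosProofs
import HarnessLib

/-!
# Odd-sector Cauchy–Schwarz for the polarised Weil functional
(crux OddBartaFloor, line Sketch, stub oddPolarDefect)

On ODD window test functions (`IsWeilTest φ`, `tsupport φ ⊆ [-a, a]`, `φ(-t) = -φ(t)`) the shifted
form `q(φ) := Re Q(φ) − ε_od(a) ∫|φ|²`, `ε_od(a) = weilOddGroundEnergy a` the bottom of Weil's
form on the odd unit sphere of the window, is non-negative (`oddEnergy_mul_le_re`, the library's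
`weilOddGroundEnergy_mul_le_re`). Its polar form along `f + t h` (`t` real; oddness is preserved)
is `q(f + t h) = q(f) + t² q(h) + t ρ` with
`ρ = Re(W(f ⋆ h̃) + W(h ⋆ f̃)) − 2 ε_od(a) Re ∫ f h̄`
(`ConnesVanSuijlekom.re_weilQuadratic_add_real_mul`, `ConnesVanSuijlekom.integral_norm_sq_add_real_mul`),
so the non-negative real quadratic `t ↦ q(f + t h)` has non-positive discriminant:
`|ρ| ≤ 2 √q(f) √q(h)` (`stub_oddPolarDefect`, curried form `abs_oddPolarDefect_le`). This is the
odd twin of `ConnesVanSuijlekom.abs_polar_le` (Bombieri 2000, §4 Problem 2 / Thm 3: `T[f * f̄*]`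
is a hermitian form bounded below; Thm 5: the odd class `μ⁻`). Elementary on top of the tree.
-/

set_option linter.dupNamespace false

noncomputable section

open Set MeasureTheory Filter Complex
open scoped Real Topology ComplexConjugate ArithmeticFunction.vonMangoldt ENNReal

namespace Summit.RiemannHypothesis.RiemannHypothesis.Theorems.OddBartaFloor

open Literature.NumberTheory.LFunctions

/-- **`q ≥ 0` on the odd window**: for an odd test function `f` supported in `[-a, a]`,
`ε_od(a) · ∫|f|² ≤ Re Q(f)` (definition of `ε_od(a)` as an infimum over the odd unit sphere,
homogeneity `Q(c f) = |c|² Q(f)` with `c f` still odd, and `Q(0) = 0`). This is the library lemma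
`Literature.NumberTheory.LFunctions.weilOddGroundEnergy_mul_le_re`, re-exported under the name
used by this line. [cite: Bombieri2000Weil, §4 Problem 2 and Thm 5] -/
theorem oddEnergy_mul_le_re {a : ℝ} {f : ℝ → ℂ} (hf : IsWeilTest f)
    (hsupp : tsupport f ⊆ Icc (-a) a) (hodd : ∀ t, f (-t) = -f t) :
    weilOddGroundEnergy a * ∫ t, ‖f t‖ ^ 2 ≤ (weilQuadratic f).re :=
  weilOddGroundEnergy_mul_le_re hf hsupp hodd

/-- **Cauchy–Schwarz for the polarised functional on the odd sector** (curried form). For odd test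
functions `f, h` on the window `[-a, a]`,
`|Re(W(f ⋆ h̃) + W(h ⋆ f̃)) − 2 ε_od(a) Re ∫ f h̄| ≤ 2 √q(f) √q(h)` with
`q(φ) = Re Q(φ) − ε_od(a) ∫|φ|² ≥ 0`: the left side is the coefficient of `t` in the non-negative
real quadratic `t ↦ q(f + t h)`, whose discriminant is therefore `≤ 0`.
[cite: Bombieri2000Weil, §4 Problem 2, Thm 3 (proof) and Thm 5] -/
theorem abs_oddPolarDefect_le {a : ℝ} {f h : ℝ → ℂ} (hf : IsWeilTest f)
    (hfs : tsupport f ⊆ Icc (-a) a) (hfo : ∀ t, f (-t) = -f t) (hh : IsWeilTest h)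
    (hhs : tsupport h ⊆ Icc (-a) a) (hho : ∀ t, h (-t) = -h t) :
    |(weilFunctional (weilConv f (weilReflect h)) + weilFunctional (weilConv h (weilReflect f))).re
        - 2 * weilOddGroundEnergy a * (∫ t, f t * conj (h t)).re| ≤
      2 * Real.sqrt ((weilQuadratic f).re - weilOddGroundEnergy a * ∫ t, ‖f t‖ ^ 2) *
        Real.sqrt ((weilQuadratic h).re - weilOddGroundEnergy a * ∫ t, ‖h t‖ ^ 2) := by
  -- adapted from `ConnesVanSuijlekom.abs_polar_le` (WeilGroundStateRealZerosProofs.lean), ε ↦ ε_od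
  set e := weilOddGroundEnergy a with he
  set qf := (weilQuadratic f).re - e * ∫ x, ‖f x‖ ^ 2 with hqf
  set qh := (weilQuadratic h).re - e * ∫ x, ‖h x‖ ^ 2 with hqh
  set X := (weilFunctional (weilConv f (weilReflect h)) +
    weilFunctional (weilConv h (weilReflect f))).re with hX
  set P := (∫ x, f x * conj (h x)).re with hP
  set ρ := X - 2 * e * P with hρ
  have hqf0 : 0 ≤ qf := by
    have := oddEnergy_mul_le_re hf hfs hfo
    simp only [hqf]; linarith
  have hqh0 : 0 ≤ qh := by
    have := oddEnergy_mul_le_re hh hhs hho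
    simp only [hqh]; linarith
  -- `q(f + t h) = qf + t² qh + t ρ` for real `t`
  have hline : ∀ t : ℝ,
      (weilQuadratic (f + fun x ↦ (t : ℂ) * h x)).re -
          e * ∫ x, ‖(f + fun x ↦ (t : ℂ) * h x) x‖ ^ 2 =
        qf + t ^ 2 * qh + t * ρ := by
    intro t
    rw [ConnesVanSuijlekom.re_weilQuadratic_add_real_mul hf hh t,
      ConnesVanSuijlekom.integral_norm_sq_add_real_mul hf hh t]
    simp only [hqf, hqh, hρ, hX, hP]
    ring
  -- each `f + t h` is an odd window test, so `q(f + t h) ≥ 0`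
  have hnonneg : ∀ t : ℝ, 0 ≤ qh * (t * t) + ρ * t + qf := by
    intro t
    have ht : IsWeilTest (f + fun x ↦ (t : ℂ) * h x) := hf.add (hh.const_mul t)
    have hts : tsupport (f + fun x ↦ (t : ℂ) * h x) ⊆ Icc (-a) a :=
      (tsupport_add _ _).trans (union_subset hfs (tsupport_mul_subset_right.trans hhs))
    have hto : ∀ s, (f + fun x ↦ (t : ℂ) * h x) (-s) = -(f + fun x ↦ (t : ℂ) * h x) s :=
      fun s ↦ by simp only [Pi.add_apply, hfo s, hho s]; ring
    have h0 := oddEnergy_mul_le_re ht hts hto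
    have h1 := hline t
    nlinarith [h0, h1]
  have hdisc : discrim qh ρ qf ≤ 0 := discrim_le_zero hnonneg
  rw [discrim] at hdisc
  have hρ2 : ρ ^ 2 ≤ (2 * Real.sqrt qf * Real.sqrt qh) ^ 2 := by
    rw [mul_pow, mul_pow, Real.sq_sqrt hqf0, Real.sq_sqrt hqh0]
    nlinarith [hdisc]
  exact abs_le_of_sq_le_sq' hρ2 (by positivity) |>.elim (fun h1 h2 ↦ abs_le.2 ⟨h1, h2⟩)

/-- **Odd-sector Cauchy–Schwarz for the polarised Weil functional** (registered stub, odd twin of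
`ConnesVanSuijlekom.abs_polar_le`): for odd window test functions `f, h` on `[-a, a]`,
`|Re(W(f ⋆ h̃) + W(h ⋆ f̃)) − 2 ε_od(a) Re ∫ f h̄| ≤ 2 √q(f) √q(h)`,
`q(φ) = Re Q(φ) − ε_od(a) ∫|φ|²`. [cite: Bombieri2000Weil, §4 Problem 2, Thm 3 (proof) and Thm 5] -/
theorem stub_oddPolarDefect :
    ∀ (a : ℝ) (f h : ℝ → ℂ), IsWeilTest f → tsupport f ⊆ Icc (-a) a → (∀ t, f (-t) = -f t) →
      IsWeilTest h → tsupport h ⊆ Icc (-a) a → (∀ t, h (-t) = -h t) →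
      |(weilFunctional (weilConv f (weilReflect h)) + weilFunctional (weilConv h (weilReflect f))).re
          - 2 * weilOddGroundEnergy a * (∫ t, f t * conj (h t)).re| ≤
        2 * Real.sqrt ((weilQuadratic f).re - weilOddGroundEnergy a * ∫ t, ‖f t‖ ^ 2) *
          Real.sqrt ((weilQuadratic h).re - weilOddGroundEnergy a * ∫ t, ‖h t‖ ^ 2) :=
  fun _ _ _ hf hfs hfo hh hhs hho ↦ abs_oddPolarDefect_le hf hfs hfo hh hhs hho

/-- The shifted odd form is non-negative: `0 ≤ Re Q(f) − ε_od(a) ∫|f|²` for odd window tests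
(corollary form of `oddEnergy_mul_le_re`, the shape under the square roots above). [folklore] -/
theorem oddShiftedForm_nonneg {a : ℝ} {f : ℝ → ℂ} (hf : IsWeilTest f)
    (hsupp : tsupport f ⊆ Icc (-a) a) (hodd : ∀ t, f (-t) = -f t) :
    0 ≤ (weilQuadratic f).re - weilOddGroundEnergy a * ∫ t, ‖f t‖ ^ 2 :=
  sub_nonneg.2 (oddEnergy_mul_le_re hf hsupp hodd)

end Summit.RiemannHypothesis.RiemannHypothesis.Theorems.OddBartaFloor

end
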